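import Summits.ResolutionOfSingularities.ResolutionOfSingularities.Theorems.ShadeCutLawJ
import HarnessLib

/-!
# ShadeCutTailTwo — decomp-res node «ShadeCut» (lens-3 g16), tree file 2/4: §S part 1 — the shade-two
window's ledger dynamics:
walk arithmetic over three named coordinates, the bundled hypotheses `TailTwo` (plateau, shade 2, positive excess),
the invariant `HasZero`,
and the `TailTwo.*` laws (L1) `D_{t+1} ≤ D_t + 1`, (L2, by LAW J) an increase forces the same chart and an
increase one move earlier,
(L3) `D` is eventually constant (`TailTwo.eventually_const`).  PROVED, 0 sorry.

Content VERBATIM from the decomp-res lens-3 g16 file `HOME/decomp-res-lens-3/g16/ShadeCut.lean` (sha256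
d031e7e4ff78d2a8…, 1829 l; CRITIC-LEDGER
row 130 CLEARED (DECIDED +1 · MAP +1), landing orders 2026-08-30T18:2xZ (row 130 rider) / 19:49:35Z (row 136:
ShadeCut FIRST, then lens-3 g17
«TightCut» as modules importing these)).  HOME = run/shared/lean/pub/decomp-res.  Host: route `MaxContactCut`,
aside 31770 `DefectWalksDeep`
through the tree's hypothesis-free `ExitLaw.defectWalksDeep_iff_joint'` and the lens-3 g15 node `Theorems/ConeCut*` (landed).

[WRITER NOTE (decomp-res writer g7): per the lens's own DELETE-ON-LANDING markers and critic row 123 h1 / row 130,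
the carried sections §V1
(g15 walk arithmetic = tree `Theorems/FloorCutFloor`), §V2 (g15 §A–§B residual-cone calculus up to the POWER
LAW = tree `Theorems/ConeCutLayers`,
`ConeCutLayersPoint`, `ConeCutWalks`) and §V3 (§AxisLaw = tree `Theorems/ConeCutAxisLaw`) are DELETED and the tree
modules imported/opened
instead (no third copy of the calculus; `exists_ne` is spelled `FloorCut.exists_ne` against Mathlib's root one); the
lens's `exists_third` (≡ tree `ConeCut.exists_third`, implicit binders) and `degree_eq_sum3`
(≡ `Finsupp.degree_eq_sum` + `Fin.sum_univ_three`, as in `FloorCutFloor`) are likewise replaced by the tree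
spellings; §L's VERBATIM g15
classes `IsTameFrom` / `NoMixedTailsDeep` / `NoTameMixedTailsDeep` are the landed `Theorems/ConeCutClasses` ones
(opened, not restated); §M
`closes` (≡ `MaxContactCutExponentLadder.closes`, a by-name re-export) is not restated.  Split: `ShadeCutLawJ`
(§J LAW J) · `ShadeCutTailTwo` /
`ShadeCutShadeTwo` (§S the shade-two theorem, PROVED; `section ShadeTwo` re-opened) · `MaxContactCutShadeCut` (§K
booking BY NAME to 31770 + §L letters).  ONE namespace `…Theorems.ShadeCut` as in the
lens; global `set_option` line dropped; the lens's `fin3_enum` (≡ the landed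
`Literature.RepresentationTheory.GeneralLinear.fin3_cases`,
dedup.landed) deleted: its two uses get a proof-local `have fin3_enum … := by decide`; nothing else changed.]
(Sources: Hauser2010 §§D,F,G; HauserPerlega2019; Moh1987; CossartPiltant2019; CossartJannsenSaito2020 Thm. 2.14,
§§5,9; BenitoVillamayor2013 §7; CasasAlvero2000 Ch. 3.)
-/

noncomputable section

open MvPolynomial Finset
open Literature.AlgebraicGeometry.Resolution
open Literature.AlgebraicGeometry.Resolution.Hauser2010
open Literature.AlgebraicGeometry.Resolution.PointBlowup
open Summit.ResolutionOfSingularities.ResolutionOfSingularities.Theses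
open Summit.ResolutionOfSingularities.ResolutionOfSingularities.Theorems.TightDefectClasses
open Summit.ResolutionOfSingularities.ResolutionOfSingularities.Theorems.TightDefectStrongWalks
open Summit.ResolutionOfSingularities.ResolutionOfSingularities.Theorems.ItineraryCutClasses
open Summit.ResolutionOfSingularities.ResolutionOfSingularities.Theorems.BoundaryLedger
open Summit.ResolutionOfSingularities.ResolutionOfSingularities.Theorems.ProximityCut
open Literature.AlgebraicGeometry.Resolution.WeightedBlowup
open Literature.Barriers.ResolutionOfSingularities
open Summit.ResolutionOfSingularities.ResolutionOfSingularities.Theorems.FloorCut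
open Summit.ResolutionOfSingularities.ResolutionOfSingularities.Theorems.ConeCutAxisLaw
open Summit.ResolutionOfSingularities.ResolutionOfSingularities.Theorems.ConeCut
open Summit.ResolutionOfSingularities.ResolutionOfSingularities.Theorems.ExitLaw (fin3_cases)

namespace Summit.ResolutionOfSingularities.ResolutionOfSingularities.Theorems.ShadeCut

/-! ## §S  THE SHADE-TWO WINDOW IS EMPTY (new, g16)

`D_t := |r_t|` on a shade-2 excess plateau (`o_t = D_t + 2 ∈ (q, 2q)`, pairs `< q` by isolation, newest mass
`x_t = D_t + 2 − q = r_{t+1}(j_t) ∈ [1, q − 2]`, ledger `D_{t+1} + q = |kept_t| + D_t + 2`):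
(L1) `D_{t+1} ≤ D_t + 1`; (L2, LAW J) an increase at move `t+1` forces the same chart and an increase at move `t`;
(L3) hence no increase after `q` moves, `D` is eventually constant; (L4) in the constant phase every move keeps mass
exactly `q − 2`, the boundary vector is FROZEN except for chart-change swaps `(x, 0, q−2) ↔ (0, x, q−2)`, repeats need
three positive coordinates and translations need a zero coordinate — so the two recurrences exclude each other. -/
section ShadeTwo

variable {K : Type} [Field K] [DecidableEq K] {q : ℕ} {s₀ : State (Fin 3) K}

/-- The boundary mass over three named coordinates. [folklore] -/
theorem degree_eq_three (r : Fin 3 →₀ ℕ) {a b k : Fin 3} (hab : a ≠ b) (hka : k ≠ a) (hkb : k ≠ b) :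
    r.degree = r a + r b + r k := by
  rw [Finsupp.degree_eq_sum, Fin.sum_univ_three]
  have fin3_enum : ∀ c : Fin 3, c = 0 ∨ c = 1 ∨ c = 2 := by decide
  rcases fin3_enum a with rfl | rfl | rfl <;> rcases fin3_enum b with rfl | rfl | rfl <;>
    rcases fin3_enum k with rfl | rfl | rfl <;>
    first | exact absurd rfl hab | exact absurd rfl hka | exact absurd rfl hkb | omega

/-- ISOLATION, pair form along a walk: `r_u(a) + r_u(c) < q`. [folklore] -/
theorem pair_lt (hroot : IsRoot q s₀) (W : ForcedWalk q s₀) (u : ℕ) {a c : Fin 3} (hac : a ≠ c) :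
    (W.st u).r a + (W.st u).r c < q :=
  pair_lt_of_isolatedTop (W.isolated u) a c hac (X_pow_mul_X_pow_dvd_of_forall_le (walk_r hroot W u) hac)

/-- `2|r_u| ≤ 3(q − 1)`. [folklore] -/
theorem two_degree_le (hroot : IsRoot q s₀) (W : ForcedWalk q s₀) (u : ℕ) :
    2 * (W.st u).r.degree + 3 ≤ 3 * q := by
  have h01 := pair_lt hroot W u (a := 0) (c := 1) (by decide)
  have h02 := pair_lt hroot W u (a := 0) (c := 2) (by decide)
  have h12 := pair_lt hroot W u (a := 1) (c := 2) (by decide)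
  rw [Finsupp.degree_eq_sum, Fin.sum_univ_three]
  omega

/-- The mass off one coordinate is a pair: `|r_u| < q + r_u(j)`. [folklore] -/
theorem degree_lt_add_coord (hroot : IsRoot q s₀) (W : ForcedWalk q s₀) (u : ℕ) (j : Fin 3) :
    (W.st u).r.degree < q + (W.st u).r j := by
  obtain ⟨a, haj⟩ := FloorCut.exists_ne j
  obtain ⟨k, hka, hkj⟩ := exists_third haj
  have h := pair_lt hroot W u (a := a) (c := k) hka.symm
  rw [degree_eq_three (W.st u).r haj hka hkj]
  omega

/-- `kept_chart`: Auxiliary step of this node's calculus, VERBATIM from the lens file (see the module docstring);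
the statement is its type. [folklore] -/
theorem kept_chart (W : ForcedWalk q s₀) (t : ℕ) : kept W t (W.j t) = 0 := by
  rw [kept_apply, if_neg (fun h => h.1 rfl)]

/-- `kept_of_ne`: Auxiliary step of this node's calculus, VERBATIM from the lens file (see the module docstring);
the statement is its type. [folklore] -/
theorem kept_of_ne (W : ForcedWalk q s₀) (t : ℕ) {i : Fin 3} (hi : i ≠ W.j t) :
    kept W t i = if W.b t i = 0 then (W.st t).r i else 0 := by
  rw [kept_apply]
  by_cases hb : W.b t i = 0
  · rw [if_pos ⟨hi, hb⟩, if_pos hb]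
  · rw [if_neg (fun h => hb h.2), if_neg hb]

/-- `|kept_t| + r_t(j_t) ≤ |r_t|`. [folklore] -/
theorem kept_degree_add_chart_le (W : ForcedWalk q s₀) (t : ℕ) :
    (kept W t).degree + (W.st t).r (W.j t) ≤ (W.st t).r.degree := by
  have h0 := kept_le W t 0
  have h1 := kept_le W t 1
  have h2 := kept_le W t 2
  have hj := kept_chart W t
  rw [Finsupp.degree_eq_sum, Fin.sum_univ_three, Finsupp.degree_eq_sum, Fin.sum_univ_three]
  have fin3_enum : ∀ c : Fin 3, c = 0 ∨ c = 1 ∨ c = 2 := by decide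
  rcases fin3_enum (W.j t) with h | h | h <;> rw [h] at hj ⊢ <;> omega

/-- A plateau keeps its shade. [folklore] -/
theorem shade_of_plateau (W : ForcedWalk q s₀) {N : ℕ} (hN : ∀ t, N ≤ t → (W.st (t + 1)).shade = (W.st t).shade)
    {x : ℕ∞} (hx : (W.st N).shade = x) : ∀ t, N ≤ t → (W.st t).shade = x := by
  intro t ht
  induction t, ht using Nat.le_induction with
  | base => exact hx
  | succ t ht ih => exact (hN t ht).trans ih

/-- The hypotheses of the SHADE-TWO WINDOW from stage `N`, bundled: plateau, shade `2`, positive excess.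
DEFINITION (support). -/
structure TailTwo (W : ForcedWalk q s₀) (N : ℕ) : Prop where
  plat : ∀ t, N ≤ t → (W.st (t + 1)).shade = (W.st t).shade
  two : (W.st N).shade = ((2 : ℕ) : ℕ∞)
  ex : ∀ t, N ≤ t → ordZero (W.st t).F ≠ ((q : ℕ) : ℕ∞)

/-- A zero coordinate of the boundary vector (the INVARIANT of the constant phase). DEFINITION (support). -/
def HasZero (W : ForcedWalk q s₀) (t : ℕ) : Prop := ∃ l, (W.st t).r l = 0

namespace TailTwo

variable {W : ForcedWalk q s₀} {N : ℕ}

/-- `shade_eq`: Auxiliary step of this node's calculus, VERBATIM from the lens file (see the module docstring); the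
statement is its type. [folklore] -/
theorem shade_eq (h : TailTwo W N) : ∀ t, N ≤ t → (W.st t).shade = ((2 : ℕ) : ℕ∞) :=
  shade_of_plateau W h.plat h.two

/-- The order window `q < o_t = |r_t| + 2 < 2q` on the tail. [folklore] -/
theorem order (hroot : IsRoot q s₀) (h : TailTwo W N) (t : ℕ) (ht : N ≤ t) :
    ∃ o : ℕ, ordZero (W.st t).F = o ∧ q < o ∧ o < 2 * q ∧ o = 2 + (W.st t).r.degree := by
  obtain ⟨o, ho, hqo, ho2⟩ := NoJump.order_lt_two_mul hroot W t
  have hne : o ≠ q := by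
    intro hoq
    exact h.ex t ht (by rw [ho, hoq])
  exact ⟨o, ho, by omega, ho2, order_eq_of_plateau hroot W ho (h.shade_eq t ht)⟩

/-- THE LEDGER of a tail move: `D_{t+1} + q = |kept_t| + D_t + 2`, newest mass `r_{t+1}(j_t) = D_t + 2 − q`,
off-chart coordinates kept. [folklore] -/
theorem step (hroot : IsRoot q s₀) (h : TailTwo W N) (t : ℕ) (ht : N ≤ t) :
    (W.st (t + 1)).r.degree + q = (kept W t).degree + (W.st t).r.degree + 2 ∧
    (W.st (t + 1)).r (W.j t) + q = (W.st t).r.degree + 2 ∧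
    ∀ i, i ≠ W.j t → (W.st (t + 1)).r i = kept W t i := by
  obtain ⟨o, ho, hqo, -, hod⟩ := h.order hroot t ht
  have hdeg := degree_r_succ W t ho
  have hch := NoJump.r_succ_chart W t ho
  refine ⟨by omega, by omega, fun i hi => ?_⟩
  rw [r_succ_eq W t ho, Finsupp.add_apply, Finsupp.single_eq_of_ne hi, add_zero]

/-- `degree_window`: Auxiliary step of this node's calculus, VERBATIM from the lens file (see the module docstring);
the statement is its type. [folklore] -/
theorem degree_window (hroot : IsRoot q s₀) (h : TailTwo W N) (t : ℕ) (ht : N ≤ t) :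
    q ≤ (W.st t).r.degree + 1 ∧ (W.st t).r.degree + 3 ≤ 2 * q := by
  obtain ⟨o, -, hqo, ho2, hod⟩ := h.order hroot t ht
  omega

/-- (L1) the boundary mass grows by at most one per move. [new] [folklore] -/
theorem degree_succ_le (hroot : IsRoot q s₀) (h : TailTwo W N) (t : ℕ) (ht : N ≤ t) :
    (W.st (t + 1)).r.degree ≤ (W.st t).r.degree + 1 := by
  obtain ⟨hd, -, -⟩ := h.step hroot t ht
  have hk := kept_degree_add_chart_le W t
  have hp := degree_lt_add_coord hroot W t (W.j t)
  omega

/-- **(L2) — LAW J AT WORK.**  An increase of the boundary mass at move `t+1` forces move `t+1` to repeat the chart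
of move `t` and the mass to have increased at move `t` as well: an increase needs kept mass `q − 1`, a chart change
keeping that much is an untranslated proximity repeat with `newest + third = q − 1`, excluded by LAW J. [new] [folklore] -/
theorem chart_eq_of_increase (hroot : IsRoot q s₀) (hq : 4 ≤ q) (h : TailTwo W N) (t : ℕ) (ht : N ≤ t)
    (hinc : (W.st (t + 2)).r.degree = (W.st (t + 1)).r.degree + 1) :
    W.j (t + 1) = W.j t ∧ (W.st (t + 1)).r.degree = (W.st t).r.degree + 1 := by
  classical
  obtain ⟨hd₁, -, -⟩ := h.step hroot (t + 1) (by omega)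
  rw [show t + 1 + 1 = t + 2 from rfl] at hd₁
  obtain ⟨-, hch₀, -⟩ := h.step hroot t ht
  have hq₀ := h.degree_window hroot t ht
  have h3 := two_degree_le hroot W t
  have hkd : (kept W (t + 1)).degree + 1 = q := by omega
  by_cases hj : W.j (t + 1) = W.j t
  · refine ⟨hj, ?_⟩
    have hk := kept_degree_add_chart_le W (t + 1)
    rw [hj] at hk
    have hle := h.degree_succ_le hroot t ht
    omega
  · exfalso
    obtain ⟨k, hk₁, hk₀⟩ := exists_third hj
    have hsum := degree_eq_three (kept W (t + 1)) hj hk₁ hk₀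
    rw [kept_chart] at hsum
    have hkj := kept_of_ne W (t + 1) (i := W.j t) (Ne.symm hj)
    have hkk := kept_of_ne W (t + 1) (i := k) hk₁
    have hpair := pair_lt hroot W (t + 1) (a := W.j t) (c := k) hk₀.symm
    by_cases hb₁ : W.b (t + 1) (W.j t) = 0
    · rw [if_pos hb₁] at hkj
      by_cases hb₂ : W.b (t + 1) k = 0
      · rw [if_pos hb₂] at hkk
        -- an UNTRANSLATED proximity repeat keeping `q − 1`: LAW J
        obtain ⟨o, ho, hqo, -, -⟩ := h.order hroot t ht
        obtain ⟨o', ho', hqo', -, -⟩ := h.order hroot (t + 1) (by omega)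
        have hJ := axis_before_untranslated_repeat hroot W t ho ho' hqo hqo' (h.plat t ht)
          (h.plat (t + 1) (by omega)) (h.shade_eq t ht) (by norm_num) ⟨hj, hb₁⟩ hk₁ hk₀ hb₂
        omega
      · rw [if_neg hb₂] at hkk
        omega
    · rw [if_neg hb₁] at hkj
      by_cases hb₂ : W.b (t + 1) k = 0
      · rw [if_pos hb₂] at hkk
        omega
      · rw [if_neg hb₂] at hkk
        omega

/-- (L3a) a chain of increases runs back to the start of the tail. [new] [folklore] -/
theorem increase_chain (hroot : IsRoot q s₀) (hq : 4 ≤ q) (h : TailTwo W N) {t : ℕ} (ht : N ≤ t) :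
    ∀ u, t ≤ u → (W.st (u + 1)).r.degree = (W.st u).r.degree + 1 →
      (W.st (u + 1)).r.degree + t = (W.st t).r.degree + u + 1 := by
  intro u hu
  induction u, hu using Nat.le_induction with
  | base =>
    intro h0
    omega
  | succ u hu ih =>
    intro hinc
    have h2 := (h.chart_eq_of_increase hroot hq u (by omega) hinc).2
    have h3 := ih h2
    omega

/-- (L3b) after `q` moves the boundary mass never increases again. [new] [folklore] -/
theorem noninc (hroot : IsRoot q s₀) (hq : 4 ≤ q) (h : TailTwo W N) (t : ℕ) (ht : N + q ≤ t) :
    (W.st (t + 1)).r.degree ≤ (W.st t).r.degree := by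
  by_contra hlt
  have hle := h.degree_succ_le hroot t (by omega)
  have hinc : (W.st (t + 1)).r.degree = (W.st t).r.degree + 1 := by omega
  have hc := h.increase_chain hroot hq (t := N) le_rfl t (by omega) hinc
  have h1 := h.degree_window hroot N le_rfl
  have h2 := h.degree_window hroot (t + 1) (by omega)
  omega

/-- (L3c) hence the boundary mass is eventually constant. [new] [folklore] -/
theorem eventually_const (hroot : IsRoot q s₀) (hq : 4 ≤ q) (h : TailTwo W N) :
    ∃ T, N + q ≤ T ∧ ∀ t, T ≤ t → (W.st t).r.degree = (W.st T).r.degree := by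
  classical
  have hex : ∃ v, ∃ t, N + q ≤ t ∧ (W.st t).r.degree = v := ⟨_, N + q, le_rfl, rfl⟩
  obtain ⟨T, hT, hTv⟩ := Nat.find_spec hex
  refine ⟨T, hT, fun t ht => le_antisymm ?_ ?_⟩
  · induction t, ht using Nat.le_induction with
    | base => exact le_rfl
    | succ t ht ih => exact (h.noninc hroot hq t (by omega)).trans ih
  · have hmin := Nat.find_min' hex ⟨t, by omega, rfl⟩
    omega

end TailTwo

end ShadeTwo

end Summit.ResolutionOfSingularities.ResolutionOfSingularities.Theorems.ShadeCut
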